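import Literature.NumberTheory.EllipticCurves.ProfiniteGroupDistribution
import HarnessLib

/-!
# Bounded distributions on a group along a subgroup tower, IV: push-forward along a group
# homomorphism, pointwise limits of distributions (de Shalit 1987, I.3.1, I.3.8 (16), II.4.14 Step 1)

Two more operations in de Shalit's `Λ(G, 𝒪) = lim 𝒪[G/H]`-currency (`GroupDistribution`,
`ProfiniteGroupDistribution.lean`), both used by the construction of the measures `μ(𝔣)`:

* §1 **push-forward along a homomorphism** `φ : G →* G'` compatible with the towers
  (`U_n ≤ φ⁻¹ U'_n`): `GroupDistribution.pushforward` — "the map induced from the projection `𝒢' → 𝒢`"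
  on `Λ(𝒢', 𝒪) → Λ(𝒢, 𝒪)` (I.3.8 (16)), inflation from a quotient, restriction of scalars along an
  inclusion of Galois groups — with `integral_pushforward : ∫ f d(φ_*μ) = ∫ (f ∘ φ) dμ` for
  tower-continuous `f` (`IsTowerContinuous.comp_hom`);
* §2 **pointwise limits**: a sequence of distributions along one tower with a common bound whose
  level data converge is a distribution (`GroupDistribution.ofTendsto`), and the integrals of every
  tower-continuous function converge to the integral against the limit
  (`tendsto_integral_ofTendsto`) — the "inverse limit is a measure" of II.4.14 Step 1 and the
  compactness/limit-point step of Coleman's I.2.2, in measure form.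

Everything is a definition with a body or a theorem; no named facts, no instances, no `sorry`.

## References

* [deShalit1987] E. de Shalit, *Iwasawa theory of elliptic curves with complex multiplication* (1987),
  I.3.1 (p. 15–16), I.3.8 (16) (p. 20), II.4.14 Step 1 (p. 71).
* [MazurTateTeitelbaum1986Invent] B. Mazur, J. Tate, J. Teitelbaum, Invent. Math. 84 (1986), §I.11.
-/

noncomputable section

open Filter
open scoped Topology Classical

namespace Literature.NumberTheory.EllipticCurves

variable {G G' : Type*} [Group G] [Group G']

/-! ### §1. Push-forward along a group homomorphism -/

namespace SubgroupTower

variable (𝒰 : SubgroupTower G) (𝒰' : SubgroupTower G')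

/-- **The cell map induced by a homomorphism compatible with the towers** (`U_n ≤ φ⁻¹ U'_n`):
`σ U_n ↦ φ(σ) U'_n`. [cite: deShalit1987, I.3.8 (16) (p. 20)] -/
def homCellMap (φ : G →* G') (hφ : ∀ n, 𝒰.U n ≤ (𝒰'.U n).comap φ) (n : ℕ) :
    G ⧸ 𝒰.U n → G' ⧸ 𝒰'.U n :=
  Quotient.map' φ fun a b h ↦ by
    rw [QuotientGroup.leftRel_apply] at h ⊢
    have h' := hφ n h
    rwa [Subgroup.mem_comap, map_mul, map_inv] at h'

variable {𝒰 𝒰'}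

/-- The cell map lies under `φ`: `homCellMap (σ U_n) = φ(σ) U'_n`. [cite: deShalit1987, I.3.8 (16) (p. 20)] -/
@[simp] theorem homCellMap_proj (φ : G →* G') (hφ : ∀ n, 𝒰.U n ≤ (𝒰'.U n).comap φ) (n : ℕ) (σ : G) :
    homCellMap 𝒰 𝒰' φ hφ n (𝒰.proj n σ) = 𝒰'.proj n (φ σ) := rfl

/-- The cell maps are compatible with the transition maps. [cite: deShalit1987, I.3.8 (16) (p. 20)] -/
theorem homCellMap_trans (φ : G →* G') (hφ : ∀ n, 𝒰.U n ≤ (𝒰'.U n).comap φ) (n : ℕ)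
    (b : G ⧸ 𝒰.U (n + 1)) :
    homCellMap 𝒰 𝒰' φ hφ n (𝒰.trans n b) = 𝒰'.trans n (homCellMap 𝒰 𝒰' φ hφ (n + 1) b) := by
  induction b using QuotientGroup.induction_on
  rfl

/-- **Pull-back of tower-continuity along a compatible homomorphism**: if `f` is tower-continuous on
`G'` then `f ∘ φ` is tower-continuous on `G`. [cite: deShalit1987, I.3.1 (p. 16)] -/
theorem IsTowerContinuous.comp_hom {E : Type*} [PseudoMetricSpace E] {f : G' → E}
    (hf : 𝒰'.IsTowerContinuous f) (φ : G →* G') (hφ : ∀ n, 𝒰.U n ≤ (𝒰'.U n).comap φ) :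
    𝒰.IsTowerContinuous (f ∘ φ) := by
  intro ε hε
  obtain ⟨N, hN⟩ := hf ε hε
  refine ⟨N, fun n hn σ τ h ↦ hN n hn (φ σ) (φ τ) ?_⟩
  rw [← homCellMap_proj φ hφ, ← homCellMap_proj φ hφ, h]

end SubgroupTower

namespace GroupDistribution

variable {𝒰 : SubgroupTower G} {𝒰' : SubgroupTower G'} {𝕜 : Type*} [NormedField 𝕜]
  [IsUltrametricDist 𝕜] (D : GroupDistribution 𝒰 𝕜)

/-- **The push-forward `φ_* μ` along a compatible homomorphism**: `(φ_*μ)_n(a') = Σ_{φ a = a'} μ_n(a)`,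
a bounded distribution along `𝒰'` with the same bound (de Shalit I.3.8 (16): the map
`Λ(𝒢', 𝒪) → Λ(𝒢, 𝒪)` induced by `𝒢' → 𝒢`). [cite: deShalit1987, I.3.8 (16) (p. 20)] -/
def pushforward (φ : G →* G') (hφ : ∀ n, 𝒰.U n ≤ (𝒰'.U n).comap φ) : GroupDistribution 𝒰' 𝕜 where
  μ n a' := ∑ a ∈ (𝒰.cells n).filter (fun a ↦ SubgroupTower.homCellMap 𝒰 𝒰' φ hφ n a = a'), D.μ n a
  sum_fiber n a' := by
    rw [Finset.sum_fiberwise_eq_sum_filter]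
    have h2 : ((𝒰.cells (n + 1)).filter fun b ↦ SubgroupTower.homCellMap 𝒰 𝒰' φ hφ (n + 1) b ∈
          (𝒰'.cells (n + 1)).filter fun b' ↦ 𝒰'.trans n b' = a') =
        (𝒰.cells (n + 1)).filter fun b ↦
          𝒰.trans n b ∈ (𝒰.cells n).filter fun a ↦ SubgroupTower.homCellMap 𝒰 𝒰' φ hφ n a = a' := by
      ext b
      simp only [Finset.mem_filter, 𝒰.mem_cells, 𝒰'.mem_cells, true_and,
        SubgroupTower.homCellMap_trans]
    rw [h2, ← Finset.sum_fiberwise_eq_sum_filter]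
    exact Finset.sum_congr rfl fun a _ ↦ D.sum_fiber n a
  bound := D.bound
  bound_nonneg := D.bound_nonneg
  norm_le n a' := IsUltrametricDist.norm_sum_le_of_forall_le_of_nonneg D.bound_nonneg
    fun a _ ↦ D.norm_le n a

/-- The level data of the push-forward. [cite: deShalit1987, I.3.8 (16) (p. 20)] -/
theorem pushforward_μ (φ : G →* G') (hφ : ∀ n, 𝒰.U n ≤ (𝒰'.U n).comap φ) (n : ℕ) (a' : G' ⧸ 𝒰'.U n) :
    (D.pushforward φ hφ).μ n a' =
      ∑ a ∈ (𝒰.cells n).filter (fun a ↦ SubgroupTower.homCellMap 𝒰 𝒰' φ hφ n a = a'), D.μ n a := rfl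

/-- The bound of the push-forward is that of `μ`. [cite: deShalit1987, I.3.8 (16) (p. 20)] -/
@[simp] theorem pushforward_bound (φ : G →* G') (hφ : ∀ n, 𝒰.U n ≤ (𝒰'.U n).comap φ) :
    (D.pushforward φ hφ).bound = D.bound := rfl

/-- **Riemann sums of the push-forward**: `RS(φ_*μ, f, n) = Σ_a μ_n(a) · f(repr'(φ a))`.
[cite: MazurTateTeitelbaum1986Invent, §I.11] -/
theorem riemannSum_pushforward (φ : G →* G') (hφ : ∀ n, 𝒰.U n ≤ (𝒰'.U n).comap φ) (f : G' → 𝕜) (n : ℕ) :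
    (D.pushforward φ hφ).riemannSum f n =
      ∑ a ∈ 𝒰.cells n, D.μ n a * f (𝒰'.repr n (SubgroupTower.homCellMap 𝒰 𝒰' φ hφ n a)) := by
  rw [riemannSum_def]
  simp only [pushforward_μ, Finset.sum_mul]
  rw [← Finset.sum_fiberwise_of_maps_to (s := 𝒰.cells n) (t := 𝒰'.cells n)
    (g := SubgroupTower.homCellMap 𝒰 𝒰' φ hφ n) (fun _ _ ↦ 𝒰'.mem_cells _ _)]
  refine Finset.sum_congr rfl fun a' _ ↦ Finset.sum_congr rfl fun a ha ↦ ?_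
  rw [(Finset.mem_filter.mp ha).2]

/-- **The Riemann sums of `φ_*μ` for `f` and of `μ` for `f ∘ φ` differ by at most `‖μ‖ · δ`** when `f`
varies by at most `δ` on the level-`n` cells of `G'`. [cite: MazurTateTeitelbaum1986Invent, §I.11] -/
theorem norm_riemannSum_pushforward_sub_le (φ : G →* G') (hφ : ∀ n, 𝒰.U n ≤ (𝒰'.U n).comap φ)
    {f : G' → 𝕜} {δ : ℝ} (hδ : 0 ≤ δ) {n : ℕ}
    (hf : ∀ x y : G', 𝒰'.proj n x = 𝒰'.proj n y → ‖f x - f y‖ ≤ δ) :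
    ‖(D.pushforward φ hφ).riemannSum f n - D.riemannSum (f ∘ φ) n‖ ≤ D.bound * δ := by
  rw [riemannSum_pushforward, riemannSum_def, ← Finset.sum_sub_distrib]
  refine IsUltrametricDist.norm_sum_le_of_forall_le_of_nonneg (mul_nonneg D.bound_nonneg hδ)
    fun a _ ↦ ?_
  rw [Function.comp_apply, ← mul_sub, norm_mul]
  refine mul_le_mul (D.norm_le n a) (hf _ _ ?_) (norm_nonneg _) D.bound_nonneg
  rw [𝒰'.proj_repr, ← SubgroupTower.homCellMap_proj φ hφ, 𝒰.proj_repr]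

/-- **Change of variables `∫ f d(φ_*μ) = ∫ (f ∘ φ) dμ`** for tower-continuous `f` on `G'`
(de Shalit I.3.8: the measures of the tower `k''k_ξ` project to those of `k_ξ`).
[cite: deShalit1987, I.3.8 (16) (p. 20)] [cite: MazurTateTeitelbaum1986Invent, §I.11] -/
theorem integral_pushforward [CompleteSpace 𝕜] (φ : G →* G') (hφ : ∀ n, 𝒰.U n ≤ (𝒰'.U n).comap φ)
    {f : G' → 𝕜} (hf : 𝒰'.IsTowerContinuous f) :
    (D.pushforward φ hφ).integral f = D.integral (f ∘ φ) := by
  have h1 : Tendsto ((D.pushforward φ hφ).riemannSum f) atTop (𝓝 ((D.pushforward φ hφ).integral f)) :=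
    (D.pushforward φ hφ).tendsto_riemannSum_integral hf
  have h2 : Tendsto (D.riemannSum (f ∘ φ)) atTop (𝓝 (D.integral (f ∘ φ))) :=
    D.tendsto_riemannSum_integral (hf.comp_hom φ hφ)
  have h0 : Tendsto (fun n ↦ (D.pushforward φ hφ).riemannSum f n - D.riemannSum (f ∘ φ) n) atTop
      (𝓝 0) := by
    refine Metric.tendsto_atTop.mpr fun ε hε ↦ ?_
    have hb : 0 < D.bound + 1 := by linarith [D.bound_nonneg]
    obtain ⟨N, hN⟩ := hf.exists_forall_norm_sub_le (div_pos hε hb)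
    refine ⟨N, fun n hn ↦ ?_⟩
    rw [dist_zero_right]
    calc ‖(D.pushforward φ hφ).riemannSum f n - D.riemannSum (f ∘ φ) n‖
        ≤ D.bound * (ε / (D.bound + 1)) :=
          D.norm_riemannSum_pushforward_sub_le φ hφ (div_pos hε hb).le (hN n hn)
      _ < ε := by
          rw [mul_div_assoc', div_lt_iff₀ hb]
          nlinarith [D.bound_nonneg]
  have h3 := h0.add h2
  simp only [sub_add_cancel, zero_add] at h3
  exact tendsto_nhds_unique h1 h3

/-! ### §2. Pointwise limits of distributions -/

/-- **A pointwise limit of distributions with a common bound is a distribution**: if `μ_k` are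
bounded distributions along `𝒰` with `‖μ_k‖ ≤ C` and `μ_k n a → ν n a` for every cell, then `ν` is a
bounded distribution with bound `C` (the distribution relation and the bound pass to the limit) —
"their inverse limit is a measure" (II.4.14 Step 1), the limit-point step of I.2.2 in measure form.
[cite: deShalit1987, II.4.14 Step 1 (p. 71), I.2.2 (p. 13–14)] -/
def ofTendsto (μ : ℕ → GroupDistribution 𝒰 𝕜) (ν : (n : ℕ) → G ⧸ 𝒰.U n → 𝕜) {C : ℝ} (hC0 : 0 ≤ C)
    (hC : ∀ k, (μ k).bound ≤ C) (hlim : ∀ (n : ℕ) (a : G ⧸ 𝒰.U n), Tendsto (fun k ↦ (μ k).μ n a) atTop (𝓝 (ν n a))) :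
    GroupDistribution 𝒰 𝕜 where
  μ := ν
  sum_fiber n a := by
    have h1 : Tendsto (fun k ↦ ∑ b ∈ (𝒰.cells (n + 1)).filter (fun b ↦ 𝒰.trans n b = a), (μ k).μ (n + 1) b)
        atTop (𝓝 (∑ b ∈ (𝒰.cells (n + 1)).filter (fun b ↦ 𝒰.trans n b = a), ν (n + 1) b)) :=
      tendsto_finsetSum _ fun b _ ↦ hlim (n + 1) b
    have h2 : (fun k ↦ ∑ b ∈ (𝒰.cells (n + 1)).filter (fun b ↦ 𝒰.trans n b = a), (μ k).μ (n + 1) b) =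
        fun k ↦ (μ k).μ n a := funext fun k ↦ (μ k).sum_fiber n a
    rw [h2] at h1
    exact tendsto_nhds_unique h1 (hlim n a)
  bound := C
  bound_nonneg := hC0
  norm_le n a := le_of_tendsto' (hlim n a).norm fun k ↦ ((μ k).norm_le n a).trans (hC k)

/-- The level data of the limit distribution. [cite: deShalit1987, II.4.14 Step 1 (p. 71)] -/
@[simp] theorem ofTendsto_μ (μ : ℕ → GroupDistribution 𝒰 𝕜) (ν : (n : ℕ) → G ⧸ 𝒰.U n → 𝕜) {C : ℝ}
    (hC0 : 0 ≤ C) (hC : ∀ k, (μ k).bound ≤ C) (hlim) (n : ℕ) (a : G ⧸ 𝒰.U n) :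
    (ofTendsto μ ν hC0 hC hlim).μ n a = ν n a := rfl

/-- The bound of the limit distribution. [cite: deShalit1987, II.4.14 Step 1 (p. 71)] -/
@[simp] theorem ofTendsto_bound (μ : ℕ → GroupDistribution 𝒰 𝕜) (ν : (n : ℕ) → G ⧸ 𝒰.U n → 𝕜) {C : ℝ}
    (hC0 : 0 ≤ C) (hC : ∀ k, (μ k).bound ≤ C) (hlim) : (ofTendsto μ ν hC0 hC hlim).bound = C := rfl

/-- The Riemann sums of the limit distribution are the limits of the Riemann sums.
[cite: deShalit1987, II.4.14 Step 1 (p. 71)] -/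
theorem tendsto_riemannSum_ofTendsto (μ : ℕ → GroupDistribution 𝒰 𝕜) (ν : (n : ℕ) → G ⧸ 𝒰.U n → 𝕜)
    {C : ℝ} (hC0 : 0 ≤ C) (hC : ∀ k, (μ k).bound ≤ C) (hlim) (f : G → 𝕜) (n : ℕ) :
    Tendsto (fun k ↦ (μ k).riemannSum f n) atTop (𝓝 ((ofTendsto μ ν hC0 hC hlim).riemannSum f n)) := by
  simp only [riemannSum_def, ofTendsto_μ]
  exact tendsto_finsetSum _ fun a _ ↦ (hlim n a).mul_const _

/-- **Integrals against a pointwise limit of uniformly bounded distributions are limits of integrals**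
(tower-continuous integrand; uniform rate `‖∫ f dμ_k − RS_n(μ_k, f)‖ ≤ C · osc_n(f)` in `k`).
[cite: deShalit1987, II.4.14 Step 1–2 (p. 71–72)] -/
theorem tendsto_integral_ofTendsto [CompleteSpace 𝕜] (μ : ℕ → GroupDistribution 𝒰 𝕜)
    (ν : (n : ℕ) → G ⧸ 𝒰.U n → 𝕜) {C : ℝ} (hC0 : 0 ≤ C) (hC : ∀ k, (μ k).bound ≤ C) (hlim)
    {f : G → 𝕜} (hf : 𝒰.IsTowerContinuous f) :
    Tendsto (fun k ↦ (μ k).integral f) atTop (𝓝 ((ofTendsto μ ν hC0 hC hlim).integral f)) := by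
  set D := ofTendsto μ ν hC0 hC hlim with hD
  refine Metric.tendsto_atTop.mpr fun ε hε ↦ ?_
  have hC1 : 0 < C + 1 := by linarith
  -- level `n` at which the oscillation of `f` is `≤ ε / (3 (C+1))`
  obtain ⟨N, hN⟩ := hf.exists_forall_norm_sub_le (div_pos hε (mul_pos three_pos hC1))
  -- the Riemann sums at level `N` converge in `k`
  obtain ⟨K₀, hK₀⟩ := Metric.tendsto_atTop.mp (tendsto_riemannSum_ofTendsto μ ν hC0 hC hlim f N)
    (ε / 3) (by positivity)
  refine ⟨K₀, fun k hk ↦ ?_⟩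
  have e1 : ‖(μ k).integral f - (μ k).riemannSum f N‖ ≤ C * (ε / (3 * (C + 1))) :=
    ((μ k).norm_integral_sub_riemannSum_le hf (div_pos hε (mul_pos three_pos hC1)).le hN le_rfl).trans
      (mul_le_mul_of_nonneg_right (hC k) (div_pos hε (mul_pos three_pos hC1)).le)
  have e2 : ‖D.integral f - D.riemannSum f N‖ ≤ C * (ε / (3 * (C + 1))) :=
    D.norm_integral_sub_riemannSum_le hf (div_pos hε (mul_pos three_pos hC1)).le hN le_rfl
  have e3 : ‖(μ k).riemannSum f N - D.riemannSum f N‖ < ε / 3 := by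
    rw [← dist_eq_norm]; exact hK₀ k hk
  have hCε : C * (ε / (3 * (C + 1))) < ε / 3 := by
    rw [mul_div_assoc', div_lt_div_iff₀ (mul_pos three_pos hC1) three_pos]
    nlinarith
  rw [dist_eq_norm]
  calc ‖(μ k).integral f - D.integral f‖
      = ‖((μ k).integral f - (μ k).riemannSum f N) + ((μ k).riemannSum f N - D.riemannSum f N) -
          (D.integral f - D.riemannSum f N)‖ := by ring_nf
    _ ≤ ‖(μ k).integral f - (μ k).riemannSum f N‖ + ‖(μ k).riemannSum f N - D.riemannSum f N‖ +
          ‖D.integral f - D.riemannSum f N‖ := norm_sub_le_of_le (norm_add_le _ _) le_rfl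
    _ < ε / 3 + ε / 3 + ε / 3 := by linarith
    _ = ε := by ring

end GroupDistribution

end Literature.NumberTheory.EllipticCurves

end
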